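import Mathlib
import Summits.ValiantsHypothesis.ValiantsHypothesis.Theorems.BarrierLeverPartitionMinorsHitByVPHiddenStatesProfileBound

/-!
# Route BarrierLever — item `PartitionMinorsHitByVP` (stmt-ValiantsHypothesis-19717), line `hidden-states`:
# CONSTRAINTS ON UNIVERSAL JOIN FAMILIES — the member-size bound (T) and the profile bound (N_j) at a universal `(h, r)`

Helper file (`--supports stmt-ValiantsHypothesis-19717`; cell valiant-natproofs, rung V4, 𝒟-side door (c), registered line
`Cruxes/PartitionMinorsHitByVP/Lines/hidden_states.lean` v2, lane `stub_universalJoinWide`; prover seat val-np-p3 gen 10).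
Bookkeeping `def`s only (`smallSets`, `enumSmallFirst`: an enumeration of the subsets of `Fin h` listing the small ones first). Closes NO item.

THE POINT. `Stmt.stub_universalJoinWide` asks for ONE join threshold family per `(h, r)` that is good for EVERY injective row family
`u : Fin r → Finset (Fin h)`. Testing such a family against the rows "all sets of size `< j` first" turns the kernel negatives
`MemberBound.card_le_of_good` and `ProfileBound.smallRows_le_smallMembers_of_good` into unconditional constraints on the design:

* `universal_card_le` — (T): if `r ≤ |B_t(h)| = Σ_{i≤t} C(h,i)`, every member of a universal family has at most `t` states;
* `universal_profile` — (N_j): for every `j`, a universal family (with `r ≤ 2^h`) has at least `min (r, |B_{j−1}(h)|)` members with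
  fewer than `j` states — its layer profile dominates the Hamming-ball profile of `[h]`.

So universal designs are radius-`t*(r)` families carrying the ball profile of ALL `h` coordinates (memo val-np-p3 g10 §4–§5: this is why
the greedy design takes `B_{t₀}([h])` first and why pieces on fewer states or deep sub-cubes fail; all 16 failures of the h = 12 window
census are (N_j) violations with corank = deficit).

WHAT THIS IS NOT: necessary conditions only; item 19717 OPEN; nothing on crux 14610 or VP ≠ VNP.
-/

set_option linter.dupNamespace false

namespace Summit.ValiantsHypothesis.ValiantsHypothesis.Theorems.BarrierLever.HiddenStates

open Finset Matrix

noncomputable section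

namespace UniversalConstraints

variable {h : ℕ}

/-! ## 1. Enumerating subsets of `Fin h`, small ones first -/

/-- The subsets of `Fin h` with fewer than `j` elements. -/
def smallSets (h j : ℕ) : Finset (Finset (Fin h)) := Finset.univ.filter fun U => U.card < j

/-- `|{U ⊆ [h] : |U| < j}| = Σ_{i<j} C(h,i)` (adapted from `Literature…PseudoDensityFourier.card_filter_card_le`). -/
theorem card_smallSets (h j : ℕ) : (smallSets h j).card = ∑ i ∈ Finset.range j, h.choose i := by
  classical
  have : smallSets h j = (Finset.range j).biUnion fun i => Finset.powersetCard i (Finset.univ : Finset (Fin h)) := by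
    ext S
    simp [smallSets, Finset.mem_powersetCard]
  rw [this, Finset.card_biUnion]
  · refine Finset.sum_congr rfl fun i _ => ?_
    rw [Finset.card_powersetCard, Finset.card_univ, Fintype.card_fin]
  · intro i _ i' _ hii'
    exact Finset.disjoint_left.2 fun S h1 h2 =>
      hii' ((Finset.mem_powersetCard.1 h1).2.symm.trans (Finset.mem_powersetCard.1 h2).2)

/-- The complement: subsets with at least `j` elements. -/
def bigSets (h j : ℕ) : Finset (Finset (Fin h)) := Finset.univ.filter fun U => ¬ U.card < j

/-- Small and big sets partition all `2^h` subsets. -/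
theorem card_smallSets_add_card_bigSets (h j : ℕ) : (smallSets h j).card + (bigSets h j).card = 2 ^ h := by
  rw [smallSets, bigSets, Finset.card_filter_add_card_filter_not, Finset.card_univ, Fintype.card_finset,
    Fintype.card_fin]

/-- An enumeration of ALL subsets of `Fin h` listing the small ones (`|U| < j`) first: positions `< |smallSets|` are small. -/
def enumSmallFirst (h j : ℕ) : Fin (2 ^ h) → Finset (Fin h) := fun i =>
  match finSumFinEquiv.symm (Fin.cast (card_smallSets_add_card_bigSets h j).symm i) with
  | Sum.inl a => ((smallSets h j).equivFin.symm a : Finset (Fin h))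
  | Sum.inr b => ((bigSets h j).equivFin.symm b : Finset (Fin h))

/-- The enumeration is injective. -/
theorem enumSmallFirst_injective (h j : ℕ) : Function.Injective (enumSmallFirst h j) := by
  classical
  intro i i' hii'
  unfold enumSmallFirst at hii'
  have key : finSumFinEquiv.symm (Fin.cast (card_smallSets_add_card_bigSets h j).symm i)
      = finSumFinEquiv.symm (Fin.cast (card_smallSets_add_card_bigSets h j).symm i') := by
    rcases hs : finSumFinEquiv.symm (Fin.cast (card_smallSets_add_card_bigSets h j).symm i) with a | b <;>
      rcases hs' : finSumFinEquiv.symm (Fin.cast (card_smallSets_add_card_bigSets h j).symm i') with a' | b' <;>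
      rw [hs, hs'] at hii' <;> simp only at hii'
    · rw [Subtype.coe_inj.mp hii' |> (smallSets h j).equivFin.symm.injective]
    · exfalso
      have h1 : ((smallSets h j).equivFin.symm a : Finset (Fin h)).card < j :=
        (Finset.mem_filter.mp ((smallSets h j).equivFin.symm a).2).2
      have h2 : ¬ ((bigSets h j).equivFin.symm b' : Finset (Fin h)).card < j :=
        (Finset.mem_filter.mp ((bigSets h j).equivFin.symm b').2).2
      rw [hii'] at h1
      exact h2 h1
    · exfalso
      have h1 : ¬ ((bigSets h j).equivFin.symm b : Finset (Fin h)).card < j :=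
        (Finset.mem_filter.mp ((bigSets h j).equivFin.symm b).2).2
      have h2 : ((smallSets h j).equivFin.symm a' : Finset (Fin h)).card < j :=
        (Finset.mem_filter.mp ((smallSets h j).equivFin.symm a').2).2
      rw [hii'] at h1
      exact h1 h2
    · rw [Subtype.coe_inj.mp hii' |> (bigSets h j).equivFin.symm.injective]
  have := finSumFinEquiv.symm.injective key
  exact Fin.cast_injective _ this

/-- The first `|smallSets h j|` entries are small. -/
theorem enumSmallFirst_small (h j : ℕ) (i : Fin (2 ^ h)) (hi : (i : ℕ) < (smallSets h j).card) :
    (enumSmallFirst h j i).card < j := by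
  unfold enumSmallFirst
  have : finSumFinEquiv.symm (Fin.cast (card_smallSets_add_card_bigSets h j).symm i) = Sum.inl ⟨i, hi⟩ := by
    rw [Equiv.symm_apply_eq]
    apply Fin.ext
    simp
  rw [this]
  have hmem := ((smallSets h j).equivFin.symm ⟨i, hi⟩).2
  simp only [smallSets, Finset.mem_filter] at hmem
  exact hmem.2

/-- The row family: the first `r ≤ 2^h` sets of the small-first enumeration. -/
def rowsSmallFirst (h j r : ℕ) (hr : r ≤ 2 ^ h) : Fin r → Finset (Fin h) := fun i => enumSmallFirst h j (Fin.castLE hr i)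

/-- It is injective … -/
theorem rowsSmallFirst_injective (h j r : ℕ) (hr : r ≤ 2 ^ h) : Function.Injective (rowsSmallFirst h j r hr) :=
  fun _ _ hii' => Fin.castLE_injective hr (enumSmallFirst_injective h j hii')

/-- … and has at least `min (r, |B_{j-1}(h)|)` rows of size `< j`. -/
theorem card_small_rowsSmallFirst (h j r : ℕ) (hr : r ≤ 2 ^ h) :
    min r (∑ i ∈ Finset.range j, h.choose i)
      ≤ (Finset.univ.filter fun i : Fin r => (rowsSmallFirst h j r hr i).card < j).card := by
  classical
  rw [← card_smallSets]
  set b := (smallSets h j).card with hb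
  -- the indices below min r b are all small rows
  have hsub : (Finset.univ.filter fun i : Fin r => (i : ℕ) < min r b)
      ⊆ Finset.univ.filter fun i : Fin r => (rowsSmallFirst h j r hr i).card < j := by
    intro i hi
    rw [Finset.mem_filter] at hi ⊢
    refine ⟨Finset.mem_univ _, ?_⟩
    exact enumSmallFirst_small h j _ (by simp; omega)
  refine le_trans ?_ (Finset.card_le_card hsub)
  -- count the indices below min r b
  have : (Finset.univ.filter fun i : Fin r => (i : ℕ) < min r b).card = min r b := by
    rw [Fin.card_filter_val_lt]; omega
  omega

/-! ## 2. The constraints -/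

variable {m K r : ℕ}

/-- **(T) for universal families.** If `r ≤ |B_t(h)|` and the join threshold family `e` is good for EVERY injective row family
`u : Fin r → Finset (Fin h)`, then every member has at most `t` states. -/
theorem universal_card_le (t : ℕ) (hr : r ≤ ∑ i ∈ Finset.range (t + 1), h.choose i) (hr2 : r ≤ 2 ^ h)
    (e : Fin r → Fin m × Finset (Fin K)) (he : Function.Injective e) (W : Fin m → ℕ) (wt : Fin m → Fin K → ℕ)
    (hthr : ∀ x : Fin m × Finset (Fin K), x ∉ Set.range e →
      ∀ i, W (e i).1 + ∑ k ∈ (e i).2, wt (e i).1 k < W x.1 + ∑ k ∈ x.2, wt x.1 k)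
    (huniv : ∀ u : Fin r → Finset (Fin h), Function.Injective u →
      ∃ tx : Fin m → Option (Fin K) → Fin h → ℂ,
        (Matrix.of fun i k : Fin r =>
          ∏ a ∈ u i, (tx (e k).1 none a + ∑ q ∈ (e k).2, tx (e k).1 (some q) a)).det ≠ 0)
    (k : Fin r) : ((e k).2).card ≤ t := by
  classical
  -- test against r distinct sets of size ≤ t (= the small-first rows with j = t+1: all of them are small since r ≤ |B_t(h)|)
  let u := rowsSmallFirst h (t + 1) r hr2
  have hsmall : ∀ i, (u i).card ≤ t := by
    intro i
    have := enumSmallFirst_small h (t + 1) (Fin.castLE hr2 i) (by rw [card_smallSets]; simp; omega)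
    exact Nat.lt_succ_iff.mp this
  exact MemberBound.card_le_of_good u t hsmall e he W wt hthr (huniv u (rowsSmallFirst_injective h (t + 1) r hr2)) k

/-- **(N_j) for universal families.** If the join threshold family `e` (with `r ≤ 2^h` columns) is good for EVERY injective row
family, then for every `j` it has at least `min (r, |B_{j−1}(h)|)` members with fewer than `j` states. -/
theorem universal_profile (j : ℕ) (hr2 : r ≤ 2 ^ h)
    (e : Fin r → Fin m × Finset (Fin K)) (W : Fin m → ℕ) (wt : Fin m → Fin K → ℕ)
    (hthr : ∀ x : Fin m × Finset (Fin K), x ∉ Set.range e →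
      ∀ i, W (e i).1 + ∑ k ∈ (e i).2, wt (e i).1 k < W x.1 + ∑ k ∈ x.2, wt x.1 k)
    (huniv : ∀ u : Fin r → Finset (Fin h), Function.Injective u →
      ∃ tx : Fin m → Option (Fin K) → Fin h → ℂ,
        (Matrix.of fun i k : Fin r =>
          ∏ a ∈ u i, (tx (e k).1 none a + ∑ q ∈ (e k).2, tx (e k).1 (some q) a)).det ≠ 0) :
    min r (∑ i ∈ Finset.range j, h.choose i) ≤ (Finset.univ.filter fun k => ((e k).2).card < j).card :=
  le_trans (card_small_rowsSmallFirst h j r hr2)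
    (ProfileBound.smallRows_le_smallMembers_of_good (rowsSmallFirst h j r hr2) j e W wt hthr
      (huniv _ (rowsSmallFirst_injective h j r hr2)))

end UniversalConstraints

end

end Summit.ValiantsHypothesis.ValiantsHypothesis.Theorems.BarrierLever.HiddenStates
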